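import Summits.HubbardSuperconductivity.HubbardSuperconductivity.Theorems.AposterioriCapRgSsbToEvenTorusLroFacePurityOfRepelledCoherence
import HarnessLib

/-!
# Route `AposterioriCapRg` — crux `SsbToEvenTorusLro` (stmt-HubbardSuperconductivity-1315),
# line `pair-yrast-landau-floor`: the every-ground-state half as a HIERARCHY with one weakest source-free ENERGY statement

The every-ground-state half of the crux is the registered stub `stub_facePurity` (FP: derivative face purity, NECESSARY
for the crux, `facePurity_of_hasDWavePairFieldLROAt`). Three sufficient physics statements now supply it, all about
the Kac-block-REPELLED grand-canonical torus `K_μ + κ W_R` (`W_R = R⁻⁴ Σ_a B_aᴴ B_a`):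

* ROP — repelled ORDER persistence (Koma–Tasaki `d`-wave order of the SOURCED repelled model, `L → ∞` then `h ↓ 0`;
  `stub_facePurity_of_repelledOrderPersistence`, p90057);
* RPC — repelled pair COHERENCE (`Re ω₀[K_μ+κW_R](W_R) ≥ cL²`, source-free, tracial;
  `stub_facePurity_of_repelledCoherence`, p97133);
* **GRC — the grand-canonical REPELLED CHORD (this file):**

  `∃ a > 0, ∀ R ≥ 1, ∃ κ > 0, eventually along even sides L:  κ·a·L² ≤ E₀(K_μ + κ W_R) − E₀(K_μ)`,

  a statement about TWO grand-canonical ground ENERGIES only — no states, no source, no order of limits, no sector.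

This file proves that GRC is the WEAKEST of the three and still sufficient:

* `gcRepelledChord_of_repelledCoherenceAt` — RPC ⇒ GRC pointwise in `(U, μ)` (variational slope
  `rpc_groundEnergy_chord_ge`);
* `gcRepelledChord_of_repelledOrderAt` — ROP ⇒ GRC pointwise in `(U, μ)` (landed S1 `stub_blockSlope` at base `κ`, step
  `t = κ`, the ROP floor, and the landed source removal S4 `stub_sourceRemoval` at `κ` and at `0`, source `h ≤ κa²/48`);
* `fp_chord_of_gcRepelledChordAt` — GRC + grand-canonical density matching ⇒ the CANONICAL chord at `(U, δ)` (landed S5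
  `stub_sectorFloorGC` + the landed `T = 0` equivalence of ensembles) and `facePurity_of_gcRepelledChordAt` (⇒ FP's
  consequent by `deriv_of_chord`); `stub_facePurity_of_gcRepelledChord` — the registered `stub_facePurity` VERBATIM from
  the guarded GRC hypothesis;
* the doors of the line through GRC: `SsbToEvenTorusLro_of_gcRepelledChord_of_infraredCeiling` (+ ceiling) and — the two
  WEAKEST halves together — `SsbToEvenTorusLro_of_gcRepelledChord_of_infraredLeak` (+ the pointwise infrared LEAK, the
  Σ-form of item stmt-1089 on the full range `δ ∈ (0,1)`, = the registered `stub_infraredLeak` of the sibling line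
  number-projected-canonical-slope); `SsbToEvenTorusLro_of_facePurity_of_infraredLeak` (FP + leak; with FP necessary,
  this is the crux's exact dissection modulo the leak, `deriv_iff_hasDWavePairFieldLROAt_of_leak`).

So the kernel-checked picture of the crux is:  ROP ⇒ GRC ⇐ RPC,  GRC ⇒ chord_can ⇒ FP,  FP ∧ leak ⇒ crux ⇒ FP,
ceiling ⇒ leak ⇐ (Y). GRC, RPC, ROP, FP (every-GS half) and Y / ceiling / leak (infrared half) are OPEN PHYSICS, NOT
filed as items; they appear here only as explicit hypotheses.

Folklore bookkeeping over the finite-dimensional variational principle (Tasaki 2020 §2.1–2.2; Koma–Tasaki 1994 §1 for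
the source inequalities, used through the landed S1/S4). No definition is introduced.
-/

noncomputable section

namespace Summit.HubbardSuperconductivity.HubbardSuperconductivity.Theorems

set_option linter.dupNamespace false

open Literature.MathematicalPhysics.QuantumLattice Literature.Probability.LatticeModels
open Literature.Barriers.HubbardSuperconductivity
open Filter Set Matrix
open scoped Matrix ComplexOrder
open _root_.Topology
open Summit.HubbardSuperconductivity.WcbcsSsbToTorusLRO.Negative
  (deriv_of_chord floor_of_deriv_of_leak hasDWavePairFieldLROAt_of_floor exists_unit_groundStateInSector
    halfFilling_floor_le_sq)
open Summit.HubbardSuperconductivity.HubbardSuperconductivity.Theorems.CwSsbToEvenTorusLRO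
  (stub_blockSlope stub_sourceRemoval stub_sectorFloorGC stub_canonicalSupportingPotential)
open Summit.HubbardSuperconductivity.HubbardSuperconductivity.Theses.AposterioriCapRg (SsbToEvenTorusLro)
open Summit.HubbardSuperconductivity.HubbardSuperconductivity.Theses.KacWindowPenalty (WindowInfraredBound)
open Summit.HubbardSuperconductivity.WcbcsSsbToTorusLRO.Negative (leak_of_windowInfraredBound)

/-- The Kac block operator `W_R = R⁻⁴ Σ_a B_aᴴ B_a` is Hermitian. [folklore] -/
private theorem grc_isHermitian_blockRepulsion (L : ℕ) [NeZero L] (R : ℕ) :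
    ((((((R : ℝ) ^ 4)⁻¹ : ℝ) : ℂ) • ∑ a : Literature.Probability.LatticeModels.TorusSite 2 L, (∑ u : Fin 2 → Fin R, localPair dWaveFormFactor L (a + fun i => ((u i : ℕ) : ZMod L)))ᴴ * (∑ u : Fin 2 → Fin R, localPair dWaveFormFactor L (a + fun i => ((u i : ℕ) : ZMod L))))).IsHermitian := by
  refine IsHermitian.smul ?_ ?_
  · exact (isSelfAdjoint_sum _ fun a _ =>
      (isHermitian_conjTranspose_mul_self _).isSelfAdjoint).isHermitian
  · rw [isSelfAdjoint_iff, Complex.star_def, Complex.conj_ofReal]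

/-! ## RPC ⇒ GRC and ROP ⇒ GRC (pointwise in `(U, μ)`) -/

/-- **Repelled pair coherence ⇒ the grand-canonical repelled chord** (pointwise in `(U, μ)`, same constants): from
`Re ω₀[K_μ+κW_R](W_R) ≥ cL²` and the variational slope `κ Re ω₀[K+κW](W) ≤ E₀(K+κW) − E₀(K)`. [folklore] -/
theorem gcRepelledChord_of_repelledCoherenceAt {U μ : ℝ}
    (hC : ∃ c : ℝ, 0 < c ∧ ∀ R : ℕ, 0 < R → ∃ κ : ℝ, 0 < κ ∧ ∀ᶠ k : ℕ in Filter.atTop, c * ((2 * k + 1 + 1 : ℕ) : ℝ) ^ 2 ≤ ((hubbardTorusWith 2 (2 * k + 1 + 1) 1 U μ + (κ : ℂ) • (((((R : ℝ) ^ 4)⁻¹ : ℝ) : ℂ) • ∑ a : Literature.Probability.LatticeModels.TorusSite 2 (2 * k + 1 + 1), (∑ u : Fin 2 → Fin R, localPair dWaveFormFactor (2 * k + 1 + 1) (a + fun i => ((u i : ℕ) : ZMod (2 * k + 1 + 1))))ᴴ * (∑ u : Fin 2 → Fin R, localPair dWaveFormFactor (2 * k + 1 + 1) (a + fun i => ((u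 i : ℕ) : ZMod (2 * k + 1 + 1)))))).groundStateFunctional (((((R : ℝ) ^ 4)⁻¹ : ℝ) : ℂ) • ∑ a : Literature.Probability.LatticeModels.TorusSite 2 (2 * k + 1 + 1), (∑ u : Fin 2 → Fin R, localPair dWaveFormFactor (2 * k + 1 + 1) (a + fun i => ((u i : ℕ) : ZMod (2 * k + 1 + 1))))ᴴ * (∑ u : Fin 2 → Fin R, localPair dWaveFormFactor (2 * k + 1 + 1) (a + fun i => ((u i : ℕ) : ZMod (2 * k + 1 + 1)))))).re) :
    ∃ a : ℝ, 0 < a ∧ ∀ R : ℕ, 0 < R → ∃ κ : ℝ, 0 < κ ∧ ∀ᶠ k : ℕ in Filter.atTop, κ * a * ((2 * k + 1 + 1 : ℕ) : ℝ) ^ 2 ≤ (hubbardTorusWith 2 (2 * k + 1 + 1) 1 U μ + (κ : ℂ) • (((((R : ℝ) ^ 4)⁻¹ : ℝ) : ℂ) • ∑ a : Literature.Probability.LatticeModels.TorusSite 2 (2 * k + 1 + 1), (∑ u : Fin 2 → Fin R, localPair dWaveFormFactor (2 * k + 1 + 1) (a + fun i => ((u i : ℕ) : ZMod (2 * k + 1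 + 1))))ᴴ * (∑ u : Fin 2 → Fin R, localPair dWaveFormFactor (2 * k + 1 + 1) (a + fun i => ((u i : ℕ) : ZMod (2 * k + 1 + 1)))))).groundEnergy - (hubbardTorusWith 2 (2 * k + 1 + 1) 1 U μ).groundEnergy := by
  obtain ⟨c, hc, hC⟩ := hC
  refine ⟨c, hc, fun R hR => ?_⟩
  obtain ⟨κ, hκ, hk⟩ := hC R hR
  refine ⟨κ, hκ, ?_⟩
  filter_upwards [hk] with k hk
  have hvar := rpc_groundEnergy_chord_ge (isHermitian_hubbardTorusWith (L := 2 * k + 1 + 1) 1 U μ)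
    (grc_isHermitian_blockRepulsion (2 * k + 1 + 1) R) κ
  have hkκ := mul_le_mul_of_nonneg_left hk hκ.le
  rw [← mul_assoc] at hkκ
  exact hkκ.trans hvar

/-- **Repelled order persistence ⇒ the grand-canonical repelled chord** (pointwise in `(U, μ)`; floor `a²/2`): with
`T_h = K_μ − h(Δ+Δᴴ)`, S1 gives `E₀(T_h + κW_R) − E₀(T_h) ≥ κ (Re ω_{T_h+κW_R}(Δ))²/L² ≥ κa²L²` (ROP floor at the
source `h = min(h₀/2, κa²/48)`), and S4 removes the source on both sides at cost `12hL²` each. [cite: KomaTasaki1994, §1] -/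
theorem gcRepelledChord_of_repelledOrderAt {U μ : ℝ}
    (hBa : ∃ a : ℝ, 0 < a ∧ ∀ R : ℕ, 0 < R → ∃ κ : ℝ, 0 < κ ∧ ∃ h₀ : ℝ, 0 < h₀ ∧ ∀ h ∈ Set.Ioo (0:ℝ) h₀, ∀ᶠ L : ℕ in Filter.atTop, a ≤ ((dWaveSourceTorus (L + 1) U μ h + (κ : ℂ) • (((((R : ℝ) ^ 4)⁻¹ : ℝ) : ℂ) • ∑ a : Literature.Probability.LatticeModels.TorusSite 2 (L + 1), (∑ u : Fin 2 → Fin R, localPair dWaveFormFactor (L + 1) (a + fun i => ((u i : ℕ) : ZMod (L + 1))))ᴴ * (∑ u : Fin 2 → Fin R, localPair dWaveFormFactor (L + 1) (a + fun i => ((u i : ℕ) : ZMod (L + 1)))))).groundStateFunctional (pairField dWaveFormFactor (L + 1))).re / ((L + 1 : ℕ) : ℝ) ^ 2) :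
    ∃ a : ℝ, 0 < a ∧ ∀ R : ℕ, 0 < R → ∃ κ : ℝ, 0 < κ ∧ ∀ᶠ k : ℕ in Filter.atTop, κ * a * ((2 * k + 1 + 1 : ℕ) : ℝ) ^ 2 ≤ (hubbardTorusWith 2 (2 * k + 1 + 1) 1 U μ + (κ : ℂ) • (((((R : ℝ) ^ 4)⁻¹ : ℝ) : ℂ) • ∑ a : Literature.Probability.LatticeModels.TorusSite 2 (2 * k + 1 + 1), (∑ u : Fin 2 → Fin R, localPair dWaveFormFactor (2 * k + 1 + 1) (a + fun i => ((u i : ℕ) : ZMod (2 * k + 1 + 1))))ᴴ * (∑ u : Fin 2 → Fin R, localPair dWaveFormFactor (2 * k + 1 + 1) (a + fun i => ((u i : ℕ) : ZMod (2 * k + 1 + 1)))))).groundEnergy - (hubbardTorusWith 2 (2 * k + 1 + 1) 1 U μ).groundEnergy := by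
  obtain ⟨a, ha, hBa⟩ := hBa
  refine ⟨a ^ 2 / 2, by positivity, fun R hR => ?_⟩
  obtain ⟨κ, hκ, h₀, hh₀, hBκ⟩ := hBa R hR
  refine ⟨κ, hκ, ?_⟩
  -- the source strength
  set h : ℝ := min (h₀ / 2) (κ * a ^ 2 / 48) with hh_def
  have hhpos : 0 < h := lt_min (by positivity) (by positivity)
  have hhIoo : h ∈ Set.Ioo (0:ℝ) h₀ := ⟨hhpos, lt_of_le_of_lt (min_le_left _ _) (by linarith)⟩
  have hh48 : 48 * h ≤ κ * a ^ 2 := by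
    have : h ≤ κ * a ^ 2 / 48 := min_le_right _ _
    linarith
  -- repelled order on the even sides (the odd numbers `2k+1` tend to infinity)
  have h21 : Tendsto (fun k : ℕ => 2 * k + 1) atTop atTop := by
    refine tendsto_atTop_mono (fun k => ?_) tendsto_id
    simp only [id]; omega
  have hBk := h21.eventually (hBκ h hhIoo)
  filter_upwards [hBk] with k hk
  -- S1 with base point κ and step t = κ
  have hS1 := stub_blockSlope (2 * k + 1 + 1) R hR U μ h κ κ hκ.le
  rw [sub_self, Complex.ofReal_zero, zero_smul, add_zero] at hS1
  -- S4 at κ and at 0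
  have hS4a := stub_sourceRemoval (2 * k + 1 + 1) R U μ h κ
  have hS4b := stub_sourceRemoval (2 * k + 1 + 1) R U μ h 0
  rw [Complex.ofReal_zero, zero_smul, add_zero, add_zero] at hS4b
  rw [abs_of_pos hhpos] at hS4a hS4b
  -- bookkeeping
  set A : ℝ := ((2 * k + 1 + 1 : ℕ) : ℝ) ^ 2 with hA_def
  have hA : 0 < A := by positivity
  set x : ℝ := ((dWaveSourceTorus (2 * k + 1 + 1) U μ h + (κ : ℂ) • (((((R : ℝ) ^ 4)⁻¹ : ℝ) : ℂ) • ∑ a : Literature.Probability.LatticeModels.TorusSite 2 (2 * k + 1 + 1), (∑ u : Fin 2 → Fin R, localPair dWaveFormFactor (2 * k + 1 + 1) (a + fun i => ((u i : ℕ) : ZMod (2 * k + 1 + 1))))ᴴ * (∑ u : Fin 2 → Fin R, localPair dWaveFormFactor (2 * k + 1 + 1) (a + fun i => ((u i : ℕ) : ZMod (2 * k + 1 + 1)))))).groundStateFunctional (pairField dWaveFormFactor (2 * k + 1 + 1))).re with hx_def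
  have hxA : a * A ≤ x := (le_div_iff₀ hA).mp hk
  have haA : 0 ≤ a * A := by positivity
  have hx2 : (a * A) ^ 2 ≤ x ^ 2 := pow_le_pow_left₀ haA hxA 2
  have h1 : κ * a ^ 2 * A ≤ κ * x ^ 2 / A := by
    rw [le_div_iff₀ hA]
    calc κ * a ^ 2 * A * A = κ * (a * A) ^ 2 := by ring
      _ ≤ κ * x ^ 2 := mul_le_mul_of_nonneg_left hx2 hκ.le
  have hneg : -κ * x ^ 2 / A = -(κ * x ^ 2 / A) := by ring
  rw [hneg] at hS1
  have h4a := abs_le.mp hS4a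
  have h4b := abs_le.mp hS4b
  have hhA : 48 * h * A ≤ κ * a ^ 2 * A := mul_le_mul_of_nonneg_right hh48 hA.le
  have e : κ * (a ^ 2 / 2) * A = κ * a ^ 2 * A - κ * a ^ 2 * A / 2 := by ring
  rw [e]
  linarith [h4a.1, h4a.2, h4b.1, h4b.2]


/-! ## The guarded forms (registered reduction stubs): (ROP) ⇒ (GRC) and (RPC) ⇒ (GRC) -/

/-- **(ROP) ⇒ (GRC) on the registered signatures**: the `∀ U > 0, δ ∈ (0,1)` repelled-order-persistence stub of the line implies the
grand-canonical repelled chord stub (pointwise `gcRepelledChord_of_repelledOrderAt`). [folklore] -/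
theorem stub_gcRepelledChord_of_repelledOrderPersistence :
    (∀ (U δ μ : ℝ), 0 < U → δ ∈ Set.Ioo (0:ℝ) 1 → Filter.Tendsto (fun L : ℕ => ((hubbardTorusWith 2 (L + 1) 1 U μ).groundStateFunctional totalNumber).re / ((L + 1 : ℕ) : ℝ) ^ 2) Filter.atTop (nhds (1 - δ)) → HasDWaveOrder U μ → ∃ a : ℝ, 0 < a ∧ ∀ R : ℕ, 0 < R → ∃ κ : ℝ, 0 < κ ∧ ∃ h₀ : ℝ, 0 < h₀ ∧ ∀ h ∈ Set.Ioo (0:ℝ) h₀, ∀ᶠ L : ℕ in Filter.atTop, a ≤ ((dWaveSourceTorus (L + 1) U μ h + (κ : ℂ) • (((((R : ℝ) ^ 4)⁻¹ : ℝ) : ℂ) • ∑ a : Literature.Probability.LatticeModels.TorusSite 2 (L + 1), (∑ u : Fin 2 → Fin R, localPair dWaveFormFactor (L + 1) (a + fun i => ((u i : ℕ) : ZMod (L + 1))))ᴴ * (∑ u : Fin 2 → Fin R, localPair dWaveFormFactor (L + 1) (a + fun i => ((u i : ℕ) : ZMod (L + 1)))))).groundStateFunctional (pairField dWaveFormFactor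 (L + 1))).re / ((L + 1 : ℕ) : ℝ) ^ 2) → ∀ (U δ μ : ℝ), 0 < U → δ ∈ Set.Ioo (0:ℝ) 1 → Filter.Tendsto (fun L : ℕ => ((hubbardTorusWith 2 (L + 1) 1 U μ).groundStateFunctional totalNumber).re / ((L + 1 : ℕ) : ℝ) ^ 2) Filter.atTop (nhds (1 - δ)) → HasDWaveOrder U μ → ∃ a : ℝ, 0 < a ∧ ∀ R : ℕ, 0 < R → ∃ κ : ℝ, 0 < κ ∧ ∀ᶠ k : ℕ in Filter.atTop, κ * a * ((2 * k + 1 + 1 : ℕ) : ℝ) ^ 2 ≤ (hubbardTorusWith 2 (2 * k + 1 + 1) 1 U μ + (κ : ℂ) • (((((R : ℝ) ^ 4)⁻¹ : ℝ) : ℂ) • ∑ a : Literature.Probability.LatticeModels.TorusSite 2 (2 * k + 1 + 1), (∑ u : Fin 2 → Fin R, localPair dWaveFormFactor (2 * k + 1 + 1) (a + fun i => ((u i : ℕ) : ZMod (2 * k + 1 + 1))))ᴴ * (∑ u : Fin 2 → Fin R, localPair dWaveFormFactor (2 * k + 1 + 1) (a + fun i => ((u i : ℕ) : ZMod (2 *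 k + 1 + 1)))))).groundEnergy - (hubbardTorusWith 2 (2 * k + 1 + 1) 1 U μ).groundEnergy :=
  fun h U δ μ hU hδ hdm hO => gcRepelledChord_of_repelledOrderAt (h U δ μ hU hδ hdm hO)

/-- **(RPC) ⇒ (GRC) on the registered signatures**: the repelled-pair-coherence stub implies the grand-canonical repelled chord
stub (pointwise `gcRepelledChord_of_repelledCoherenceAt`). [folklore] -/
theorem stub_gcRepelledChord_of_repelledCoherence :
    (∀ (U δ μ : ℝ), 0 < U → δ ∈ Set.Ioo (0:ℝ) 1 → Filter.Tendsto (fun L : ℕ => ((hubbardTorusWith 2 (L + 1) 1 U μ).groundStateFunctional totalNumber).re / ((L + 1 : ℕ) : ℝ) ^ 2) Filter.atTop (nhds (1 - δ)) → HasDWaveOrder U μ → ∃ c : ℝ, 0 < c ∧ ∀ R : ℕ, 0 < R → ∃ κ : ℝ, 0 < κ ∧ ∀ᶠ k : ℕ in Filter.atTop, c * ((2 * k + 1 + 1 : ℕ) : ℝ) ^ 2 ≤ ((hubbardTorusWith 2 (2 * k + 1 + 1) 1 U μ + (κ : ℂ) • (((((R : ℝ) ^ 4)⁻¹ : ℝ)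 : ℂ) • ∑ a : Literature.Probability.LatticeModels.TorusSite 2 (2 * k + 1 + 1), (∑ u : Fin 2 → Fin R, localPair dWaveFormFactor (2 * k + 1 + 1) (a + fun i => ((u i : ℕ) : ZMod (2 * k + 1 + 1))))ᴴ * (∑ u : Fin 2 → Fin R, localPair dWaveFormFactor (2 * k + 1 + 1) (a + fun i => ((u i : ℕ) : ZMod (2 * k + 1 + 1)))))).groundStateFunctional (((((R : ℝ) ^ 4)⁻¹ : ℝ) : ℂ) • ∑ a : Literature.Probability.LatticeModels.TorusSite 2 (2 * k + 1 + 1), (∑ u : Fin 2 → Fin R, localPair dWaveFormFactor (2 * k + 1 + 1) (a + fun i => ((u i : ℕ) : ZMod (2 * k + 1 + 1))))ᴴ * (∑ u : Fin 2 → Fin R, localPair dWaveFormFactor (2 * k + 1 + 1) (a + fun i => ((u i : ℕ) : ZMod (2 * k + 1 + 1)))))).re) → ∀ (U δ μ : ℝ), 0 < U → δ ∈ Set.Ioo (0:ℝ) 1 → Filter.Tendsto (fun L : ℕ => ((hubbardTorusWith 2 (L + 1) 1 U μ).groundStateFunctional totalNumber).re / ((L + 1 : ℕ) : ℝ) ^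 2) Filter.atTop (nhds (1 - δ)) → HasDWaveOrder U μ → ∃ a : ℝ, 0 < a ∧ ∀ R : ℕ, 0 < R → ∃ κ : ℝ, 0 < κ ∧ ∀ᶠ k : ℕ in Filter.atTop, κ * a * ((2 * k + 1 + 1 : ℕ) : ℝ) ^ 2 ≤ (hubbardTorusWith 2 (2 * k + 1 + 1) 1 U μ + (κ : ℂ) • (((((R : ℝ) ^ 4)⁻¹ : ℝ) : ℂ) • ∑ a : Literature.Probability.LatticeModels.TorusSite 2 (2 * k + 1 + 1), (∑ u : Fin 2 → Fin R, localPair dWaveFormFactor (2 * k + 1 + 1) (a + fun i => ((u i : ℕ) : ZMod (2 * k + 1 + 1))))ᴴ * (∑ u : Fin 2 → Fin R, localPair dWaveFormFactor (2 * k + 1 + 1) (a + fun i => ((u i : ℕ) : ZMod (2 * k + 1 + 1)))))).groundEnergy - (hubbardTorusWith 2 (2 * k + 1 + 1) 1 U μ).groundEnergy :=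
  fun h U δ μ hU hδ hdm hO => gcRepelledChord_of_repelledCoherenceAt (h U δ μ hU hδ hdm hO)

/-! ## GRC + density matching ⇒ the canonical chord ⇒ derivative face purity -/

/-- **Pointwise canonical chord from the grand-canonical repelled chord (sorry-free).** At `(U, δ, μ)`, `δ ∈ (0,1)`:
grand-canonical density matching at `μ` and the GRC floor at `(U, μ)` give the CHORD form of face purity at `(U, δ)`
with floor `a/2`: `κ (a/2) L² ≤ E_sec(H + κW_R)(N_L, 0) − E_sec(H)(N_L, 0)` eventually along even sides
(`stub_sectorFloorGC` + `fp_canonicalGCEquivalence_of_csp_of_densityMatched` at resolution `κa/2`). [folklore] -/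
theorem fp_chord_of_gcRepelledChordAt {U δ μ : ℝ} (hδ : δ ∈ Set.Ioo (0:ℝ) 1)
    (hdm : Filter.Tendsto (fun L : ℕ => ((hubbardTorusWith 2 (L + 1) 1 U μ).groundStateFunctional totalNumber).re / ((L + 1 : ℕ) : ℝ) ^ 2) Filter.atTop (nhds (1 - δ)))
    (hG : ∃ a : ℝ, 0 < a ∧ ∀ R : ℕ, 0 < R → ∃ κ : ℝ, 0 < κ ∧ ∀ᶠ k : ℕ in Filter.atTop, κ * a * ((2 * k + 1 + 1 : ℕ) : ℝ) ^ 2 ≤ (hubbardTorusWith 2 (2 * k + 1 + 1) 1 U μ + (κ : ℂ) • (((((R : ℝ) ^ 4)⁻¹ : ℝ) : ℂ) • ∑ a : Literature.Probability.LatticeModels.TorusSite 2 (2 * k + 1 + 1), (∑ u : Fin 2 → Fin R, localPair dWaveFormFactor (2 * k + 1 + 1) (a + fun i => ((u i : ℕ) : ZMod (2 * k + 1 + 1))))ᴴ * (∑ u : Fin 2 → Fin R, localPair dWaveFormFactor (2 * k + 1 + 1) (a + fun i => ((u i : ℕ) : ZMod (2 * k + 1 + 1)))))).groundEnergy - (hubbardTorusWith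 2 (2 * k + 1 + 1) 1 U μ).groundEnergy) :
    (∃ a : ℝ, 0 < a ∧ ∀ R : ℕ, 0 < R → ∃ κ : ℝ, 0 < κ ∧ ∀ᶠ k : ℕ in Filter.atTop,
    κ * a * ((2 * k + 1 + 1 : ℕ) : ℝ) ^ 2 ≤
      (hubbardTorus 2 (2 * k + 1 + 1) 1 U + (κ : ℂ) • (((((R : ℝ) ^ 4)⁻¹ : ℝ) : ℂ) • ∑ a : Literature.Probability.LatticeModels.TorusSite 2 (2 * k + 1 + 1), ((∑ u : Fin 2 → Fin R, localPair dWaveFormFactor ((2 * k + 1 + 1)) (a + fun i => ((u i : ℕ) : ZMod ((2 * k + 1 + 1))))))ᴴ * ((∑ u : Fin 2 → Fin R, localPair dWaveFormFactor ((2 * k + 1 + 1)) (a + fun i => ((u i : ℕ) : ZMod ((2 * k + 1 + 1)))))))).minEnergyOn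
          (szSector (2 * ⌊(1 - δ) * (((2 * k + 1 + 1) : ℕ) : ℝ) ^ 2 / 2⌋₊) 0) -
        (hubbardTorus 2 (2 * k + 1 + 1) 1 U).minEnergyOn (szSector (2 * ⌊(1 - δ) * (((2 * k + 1 + 1) : ℕ) : ℝ) ^ 2 / 2⌋₊) 0)) := by
  obtain ⟨a, ha, hG⟩ := hG
  have hδ1 : δ ≤ 1 := hδ.2.le
  have hδ0 : 0 ≤ δ := hδ.1.le
  have hcge := fp_canonicalGCEquivalence_of_csp_of_densityMatched (U := U) (μ := μ) hδ1
    (stub_canonicalSupportingPotential U δ hδ) hdm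
  refine ⟨a / 2, by positivity, fun R hR => ?_⟩
  obtain ⟨κ, hκ, hk⟩ := hG R hR
  refine ⟨κ, hκ, ?_⟩
  obtain ⟨L₁, hL₁⟩ := hcge (κ * a / 2) (by positivity)
  filter_upwards [hk, eventually_ge_atTop L₁] with k hk hkL
  have hEven : Even (2 * k + 1 + 1) := ⟨k + 1, by ring⟩
  have hL₁' : L₁ ≤ 2 * k + 1 + 1 := by omega
  have hcgek := hL₁ (2 * k + 1 + 1) hL₁' hEven
  have hne : ∃ φ : Fock (Orb (FermionTorus 2 (2 * k + 1 + 1))),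
      φ ∈ szSector (2 * ⌊(1 - δ) * (((2 * k + 1 + 1 : ℕ) : ℝ)) ^ 2 / 2⌋₊) 0 ∧ φ ≠ 0 := by
    obtain ⟨ψ, -, hψ⟩ := exists_unit_groundStateInSector (2 * k + 1 + 1) U
      (halfFilling_floor_le_sq (2 * k + 1 + 1) hδ0)
    exact ⟨ψ, hψ.1, hψ.2.1⟩
  have hS5 := stub_sectorFloorGC (2 * k + 1 + 1) R U μ κ _ hne
  have e : κ * (a / 2) * ((2 * k + 1 + 1 : ℕ) : ℝ) ^ 2 =
      κ * a * ((2 * k + 1 + 1 : ℕ) : ℝ) ^ 2 - κ * a / 2 * ((2 * k + 1 + 1 : ℕ) : ℝ) ^ 2 := by ring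
  rw [e]
  linarith [hS5, hk, hcgek]

/-- **Derivative face purity at `(U, δ)` from the grand-canonical repelled chord at `(U, μ)`** (pointwise, no window,
no source): EXACTLY the consequent of the registered stub `stub_facePurity` at `(U, δ)`, floor `a/2`
(`fp_chord_of_gcRepelledChordAt`, then the landed `deriv_of_chord`). [folklore] -/
theorem facePurity_of_gcRepelledChordAt {U δ μ : ℝ} (hδ : δ ∈ Set.Ioo (0:ℝ) 1)
    (hdm : Filter.Tendsto (fun L : ℕ => ((hubbardTorusWith 2 (L + 1) 1 U μ).groundStateFunctional totalNumber).re / ((L + 1 : ℕ) : ℝ) ^ 2) Filter.atTop (nhds (1 - δ)))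
    (hG : ∃ a : ℝ, 0 < a ∧ ∀ R : ℕ, 0 < R → ∃ κ : ℝ, 0 < κ ∧ ∀ᶠ k : ℕ in Filter.atTop, κ * a * ((2 * k + 1 + 1 : ℕ) : ℝ) ^ 2 ≤ (hubbardTorusWith 2 (2 * k + 1 + 1) 1 U μ + (κ : ℂ) • (((((R : ℝ) ^ 4)⁻¹ : ℝ) : ℂ) • ∑ a : Literature.Probability.LatticeModels.TorusSite 2 (2 * k + 1 + 1), (∑ u : Fin 2 → Fin R, localPair dWaveFormFactor (2 * k + 1 + 1) (a + fun i => ((u i : ℕ) : ZMod (2 * k + 1 + 1))))ᴴ * (∑ u : Fin 2 → Fin R, localPair dWaveFormFactor (2 * k + 1 + 1) (a + fun i => ((u i : ℕ) : ZMod (2 * k + 1 + 1)))))).groundEnergy - (hubbardTorusWith 2 (2 * k + 1 + 1) 1 U μ).groundEnergy) :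
    ∃ a : ℝ, 0 < a ∧ ∀ R : ℕ, 0 < R → ∀ᶠ k : ℕ in Filter.atTop, ∀ ψ : Fock (Orb (FermionTorus 2 (2 * k + 1 + 1))), IsGroundStateInSector (hubbardTorus 2 (2 * k + 1 + 1) 1 U) (2 * ⌊(1 - δ) * ((2 * k + 1 + 1 : ℕ) : ℝ) ^ 2 / 2⌋₊) 0 ψ → star ψ ⬝ᵥ ψ = 1 → a * ((2 * k + 1 + 1 : ℕ) : ℝ) ^ 2 ≤ (star ψ ⬝ᵥ ((((((R : ℝ) ^ 4)⁻¹ : ℝ) : ℂ) • ∑ x : TorusSite 2 (2 * k + 1 + 1), (∑ u : Fin 2 → Fin R, localPair dWaveFormFactor (2 * k + 1 + 1) (x + fun i => ((u i : ℕ) : ZMod (2 * k + 1 + 1))))ᴴ * (∑ u : Fin 2 → Fin R, localPair dWaveFormFactor (2 * k + 1 + 1) (x + fun i => ((u i : ℕ) : ZMod (2 * k + 1 + 1))))) *ᵥ ψ)).re :=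
  deriv_of_chord (fp_chord_of_gcRepelledChordAt hδ hdm hG)

/-- **The registered stub `stub_facePurity` from the GRAND-CANONICAL REPELLED CHORD (sorry-free reduction; the weakest
source-free door).** Antecedent: under the crux guards at `(U, δ, μ)`, one `a > 0` such that at every block scale
`R ≥ 1` some repulsive block coupling `κ > 0` raises the grand-canonical ground energy at first order,
`κ·a·L² ≤ E₀(K_μ + κW_R) − E₀(K_μ)`, eventually along even sides. It is OPEN PHYSICS (it fails exactly at an
iso-`μ`, iso-density coexistence of the `d`-wave phase with a pair-incoherent phase), NOT filed as an item, and appears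
here only as the antecedent; it is implied by ROP (`gcRepelledChord_of_repelledOrderAt`) and by RPC
(`gcRepelledChord_of_repelledCoherenceAt`). Consequent: the registered signature of `stub_facePurity` VERBATIM. [folklore] -/
theorem stub_facePurity_of_gcRepelledChord :
    (∀ (U δ μ : ℝ), 0 < U → δ ∈ Set.Ioo (0:ℝ) 1 → Filter.Tendsto (fun L : ℕ => ((hubbardTorusWith 2 (L + 1) 1 U μ).groundStateFunctional totalNumber).re / ((L + 1 : ℕ) : ℝ) ^ 2) Filter.atTop (nhds (1 - δ)) → HasDWaveOrder U μ → ∃ a : ℝ, 0 < a ∧ ∀ R : ℕ, 0 < R → ∃ κ : ℝ, 0 < κ ∧ ∀ᶠ k : ℕ in Filter.atTop, κ * a * ((2 * k + 1 + 1 : ℕ) : ℝ) ^ 2 ≤ (hubbardTorusWith 2 (2 * k + 1 + 1) 1 U μ + (κ : ℂ) • (((((R : ℝ) ^ 4)⁻¹ : ℝ) : ℂ) • ∑ a : Literature.Probability.LatticeModels.TorusSite 2 (2 * k + 1 + 1), (∑ u : Fin 2 → Fin R, localPair dWaveFormFactor (2 * k + 1 + 1) (a + fun i => ((u i : ℕ)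 : ZMod (2 * k + 1 + 1))))ᴴ * (∑ u : Fin 2 → Fin R, localPair dWaveFormFactor (2 * k + 1 + 1) (a + fun i => ((u i : ℕ) : ZMod (2 * k + 1 + 1)))))).groundEnergy - (hubbardTorusWith 2 (2 * k + 1 + 1) 1 U μ).groundEnergy) → ∀ (U δ μ : ℝ), 0 < U → δ ∈ Set.Ioo (0:ℝ) 1 → Filter.Tendsto (fun L : ℕ => ((hubbardTorusWith 2 (L + 1) 1 U μ).groundStateFunctional totalNumber).re / ((L + 1 : ℕ) : ℝ) ^ 2) Filter.atTop (nhds (1 - δ)) → HasDWaveOrder U μ → ∃ a : ℝ, 0 < a ∧ ∀ R : ℕ, 0 < R → ∀ᶠ k : ℕ in Filter.atTop, ∀ ψ : Fock (Orb (FermionTorus 2 (2 * k + 1 + 1))), IsGroundStateInSector (hubbardTorus 2 (2 * k + 1 + 1) 1 U) (2 * ⌊(1 - δ) * ((2 * k + 1 + 1 : ℕ) : ℝ) ^ 2 / 2⌋₊) 0 ψ → star ψ ⬝ᵥ ψ = 1 → a * ((2 * k + 1 + 1 : ℕ) : ℝ) ^ 2 ≤ (star ψ ⬝ᵥ ((((((R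 : ℝ) ^ 4)⁻¹ : ℝ) : ℂ) • ∑ x : TorusSite 2 (2 * k + 1 + 1), (∑ u : Fin 2 → Fin R, localPair dWaveFormFactor (2 * k + 1 + 1) (x + fun i => ((u i : ℕ) : ZMod (2 * k + 1 + 1))))ᴴ * (∑ u : Fin 2 → Fin R, localPair dWaveFormFactor (2 * k + 1 + 1) (x + fun i => ((u i : ℕ) : ZMod (2 * k + 1 + 1))))) *ᵥ ψ)).re :=
  fun hG U δ μ hU hδ hdm hO => facePurity_of_gcRepelledChordAt hδ hdm (hG U δ μ hU hδ hdm hO)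

/-! ## The doors of the line through GRC and through the infrared LEAK -/

/-- **Crux glue, door 4′: (GRC) ∧ (infrared ceiling) ⇒ `SsbToEvenTorusLro`** (through `stub_facePurity_of_gcRepelledChord`
and the landed door 3 `SsbToEvenTorusLro_of_facePurity_of_infraredCeiling`). [folklore] -/
theorem SsbToEvenTorusLro_of_gcRepelledChord_of_infraredCeiling
    (hG : ∀ (U δ μ : ℝ), 0 < U → δ ∈ Set.Ioo (0:ℝ) 1 → Filter.Tendsto (fun L : ℕ => ((hubbardTorusWith 2 (L + 1) 1 U μ).groundStateFunctional totalNumber).re / ((L + 1 : ℕ) : ℝ) ^ 2) Filter.atTop (nhds (1 - δ)) → HasDWaveOrder U μ → ∃ a : ℝ, 0 < a ∧ ∀ R : ℕ, 0 < R → ∃ κ : ℝ, 0 < κ ∧ ∀ᶠ k : ℕ in Filter.atTop, κ * a * ((2 * k + 1 + 1 : ℕ) : ℝ) ^ 2 ≤ (hubbardTorusWith 2 (2 * k + 1 + 1) 1 U μ + (κ : ℂ) • (((((R : ℝ) ^ 4)⁻¹ : ℝ) : ℂ) • ∑ a : Literature.Probability.LatticeModels.TorusSite 2 (2 * k + 1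 + 1), (∑ u : Fin 2 → Fin R, localPair dWaveFormFactor (2 * k + 1 + 1) (a + fun i => ((u i : ℕ) : ZMod (2 * k + 1 + 1))))ᴴ * (∑ u : Fin 2 → Fin R, localPair dWaveFormFactor (2 * k + 1 + 1) (a + fun i => ((u i : ℕ) : ZMod (2 * k + 1 + 1)))))).groundEnergy - (hubbardTorusWith 2 (2 * k + 1 + 1) 1 U μ).groundEnergy)
    (hIR : ∀ (U δ μ : ℝ), 0 < U → δ ∈ Set.Ioo (0:ℝ) 1 → Filter.Tendsto (fun L : ℕ => ((hubbardTorusWith 2 (L + 1) 1 U μ).groundStateFunctional totalNumber).re / ((L + 1 : ℕ) : ℝ) ^ 2) Filter.atTop (nhds (1 - δ)) → HasDWaveOrder U μ → ∃ A α η : ℝ, α < 2 ∧ 0 < η ∧ ∀ᶠ k : ℕ in Filter.atTop, ∀ ψ : Fock (Orb (FermionTorus 2 (2 * k + 1 + 1))), IsGroundStateInSector (hubbardTorus 2 (2 * k + 1 + 1) 1 U) (2 * ⌊(1 - δ) * ((2 * k + 1 + 1 : ℕ) : ℝ) ^ 2 / 2⌋₊) 0 ψ → star ψ ⬝ᵥ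 ψ = 1 → ∀ m : TorusSite 2 (2 * k + 1 + 1), m ≠ 0 → momentumNormSq (2 * k + 1 + 1) m ≤ η ^ 2 → pairStructureFactor dWaveFormFactor (2 * k + 1 + 1) ψ m ≤ A * (momentumNormSq (2 * k + 1 + 1) m ^ (α / 2))⁻¹) :
    SsbToEvenTorusLro :=
  SsbToEvenTorusLro_of_facePurity_of_infraredCeiling (stub_facePurity_of_gcRepelledChord hG) hIR

/-- **Crux glue, door 5: (FP) ∧ (infrared LEAK) ⇒ `SsbToEvenTorusLro`** — derivative face purity (NECESSARY for the
crux) plus the WEAKEST infrared input: the pointwise Σ-form leak "`Σ_{0<|q_m|<η} S_ψ(m) ≤ b L²` for every sector ground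
state, eventually, for every `b > 0` and some `η(b) > 0`" on the FULL range `δ ∈ (0,1)` (the registered
`stub_infraredLeak` of the sibling line number-projected-canonical-slope, verbatim; the pointwise content of item
stmt-1089 where `δ < 1/2`). By the landed `deriv_iff_hasDWavePairFieldLROAt_of_leak`, MODULO the leak the crux IS
(FP). [folklore] -/
theorem SsbToEvenTorusLro_of_facePurity_of_infraredLeak
    (hFP : ∀ (U δ μ : ℝ), 0 < U → δ ∈ Set.Ioo (0:ℝ) 1 → Filter.Tendsto (fun L : ℕ => ((hubbardTorusWith 2 (L + 1) 1 U μ).groundStateFunctional totalNumber).re / ((L + 1 : ℕ) : ℝ) ^ 2) Filter.atTop (nhds (1 - δ)) → HasDWaveOrder U μ → ∃ a : ℝ, 0 < a ∧ ∀ R : ℕ, 0 < R → ∀ᶠ k : ℕ in Filter.atTop, ∀ ψ : Fock (Orb (FermionTorus 2 (2 * k + 1 + 1))), IsGroundStateInSector (hubbardTorus 2 (2 * k + 1 + 1) 1 U) (2 * ⌊(1 - δ) * ((2 * k + 1 + 1 : ℕ) : ℝ) ^ 2 / 2⌋₊) 0 ψ → star ψ ⬝ᵥ ψ = 1 → a *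 ((2 * k + 1 + 1 : ℕ) : ℝ) ^ 2 ≤ (star ψ ⬝ᵥ ((((((R : ℝ) ^ 4)⁻¹ : ℝ) : ℂ) • ∑ x : TorusSite 2 (2 * k + 1 + 1), (∑ u : Fin 2 → Fin R, localPair dWaveFormFactor (2 * k + 1 + 1) (x + fun i => ((u i : ℕ) : ZMod (2 * k + 1 + 1))))ᴴ * (∑ u : Fin 2 → Fin R, localPair dWaveFormFactor (2 * k + 1 + 1) (x + fun i => ((u i : ℕ) : ZMod (2 * k + 1 + 1))))) *ᵥ ψ)).re)
    (hL : ∀ (U δ μ : ℝ), 0 < U → δ ∈ Set.Ioo (0:ℝ) 1 → Filter.Tendsto (fun L : ℕ => ((hubbardTorusWith 2 (L + 1) 1 U μ).groundStateFunctional totalNumber).re / ((L + 1 : ℕ) : ℝ) ^ 2) Filter.atTop (nhds (1 - δ)) → HasDWaveOrder U μ → ∀ b : ℝ, 0 < b → ∃ η : ℝ, 0 < η ∧ ∀ᶠ k : ℕ in Filter.atTop, ∀ ψ : Fock (Orb (FermionTorus 2 (2 * k + 1 + 1))), IsGroundStateInSector (hubbardTorus 2 (2 * k + 1 + 1) 1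 U) (2 * ⌊(1 - δ) * ((((2 * k + 1 + 1)) : ℕ) : ℝ) ^ 2 / 2⌋₊) 0 ψ → star ψ ⬝ᵥ ψ = 1 → (∑ m ∈ (Finset.univ.filter fun m : Literature.Probability.LatticeModels.TorusSite 2 (2 * k + 1 + 1) => m ≠ 0 ∧ momentumNormSq (2 * k + 1 + 1) m < η ^ 2), pairStructureFactor dWaveFormFactor (2 * k + 1 + 1) ψ m) / (((2 * k + 1 + 1) : ℕ) : ℝ) ^ 2 ≤ b) :
    SsbToEvenTorusLro :=
  fun U δ μ hU hδ hdm hO =>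
    hasDWavePairFieldLROAt_of_floor (floor_of_deriv_of_leak (hFP U δ μ hU hδ hdm hO) (hL U δ μ hU hδ hdm hO))

/-- **Crux glue, door 6: the two WEAKEST halves — (GRC) ∧ (infrared LEAK) ⇒ `SsbToEvenTorusLro`.** The crux from one
statement about two grand-canonical ground energies of the block-repelled source-free torus (every-ground-state half) and
the pointwise Σ-form infrared leak (infrared half). [folklore] -/
theorem SsbToEvenTorusLro_of_gcRepelledChord_of_infraredLeak
    (hG : ∀ (U δ μ : ℝ), 0 < U → δ ∈ Set.Ioo (0:ℝ) 1 → Filter.Tendsto (fun L : ℕ => ((hubbardTorusWith 2 (L + 1) 1 U μ).groundStateFunctional totalNumber).re / ((L + 1 : ℕ) : ℝ) ^ 2) Filter.atTop (nhds (1 - δ)) → HasDWaveOrder U μ → ∃ a : ℝ, 0 < a ∧ ∀ R : ℕ, 0 < R → ∃ κ : ℝ, 0 < κ ∧ ∀ᶠ k : ℕ in Filter.atTop, κ * a * ((2 * k + 1 + 1 : ℕ) : ℝ) ^ 2 ≤ (hubbardTorusWith 2 (2 * k + 1 + 1) 1 U μ + (κ : ℂ) • (((((R : ℝ) ^ 4)⁻¹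 : ℝ) : ℂ) • ∑ a : Literature.Probability.LatticeModels.TorusSite 2 (2 * k + 1 + 1), (∑ u : Fin 2 → Fin R, localPair dWaveFormFactor (2 * k + 1 + 1) (a + fun i => ((u i : ℕ) : ZMod (2 * k + 1 + 1))))ᴴ * (∑ u : Fin 2 → Fin R, localPair dWaveFormFactor (2 * k + 1 + 1) (a + fun i => ((u i : ℕ) : ZMod (2 * k + 1 + 1)))))).groundEnergy - (hubbardTorusWith 2 (2 * k + 1 + 1) 1 U μ).groundEnergy)
    (hL : ∀ (U δ μ : ℝ), 0 < U → δ ∈ Set.Ioo (0:ℝ) 1 → Filter.Tendsto (fun L : ℕ => ((hubbardTorusWith 2 (L + 1) 1 U μ).groundStateFunctional totalNumber).re / ((L + 1 : ℕ) : ℝ) ^ 2) Filter.atTop (nhds (1 - δ)) → HasDWaveOrder U μ → ∀ b : ℝ, 0 < b → ∃ η : ℝ, 0 < η ∧ ∀ᶠ k : ℕ in Filter.atTop, ∀ ψ : Fock (Orb (FermionTorus 2 (2 * k + 1 + 1))), IsGroundStateInSector (hubbardTorus 2 (2 * k + 1 + 1) 1 U) (2 * ⌊(1 - δ) * ((((2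 * k + 1 + 1)) : ℕ) : ℝ) ^ 2 / 2⌋₊) 0 ψ → star ψ ⬝ᵥ ψ = 1 → (∑ m ∈ (Finset.univ.filter fun m : Literature.Probability.LatticeModels.TorusSite 2 (2 * k + 1 + 1) => m ≠ 0 ∧ momentumNormSq (2 * k + 1 + 1) m < η ^ 2), pairStructureFactor dWaveFormFactor (2 * k + 1 + 1) ψ m) / (((2 * k + 1 + 1) : ℕ) : ℝ) ^ 2 ≤ b) :
    SsbToEvenTorusLro :=
  SsbToEvenTorusLro_of_facePurity_of_infraredLeak (stub_facePurity_of_gcRepelledChord hG) hL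


/-! ## Route level: the summit needs NO symmetry-breaking hypothesis — density matching, GRC at one point, and item stmt-1089 -/

/-- **The summit from ONE density-matched point carrying the grand-canonical repelled chord, plus item stmt-1089.** If at some
`U > 0`, `δ ∈ (0, 1/2)`, `μ` the grand-canonical tracial density tends to `1 − δ` AND the GRC floor holds at `(U, μ)` (one `a > 0`; for
every block scale `R ≥ 1` a coupling `κ > 0` with `κ·a·L² ≤ E₀(K_μ + κW_R) − E₀(K_μ)` eventually along even sides), then
`KacWindowPenalty.WindowInfraredBound` (item stmt-1089, by name) gives `HubbardSuperconductivity`: derivative face purity from GRC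
(`facePurity_of_gcRepelledChordAt`, NO `HasDWaveOrder` needed), the leak from 1089 (`leak_of_windowInfraredBound`), the floor by the landed
Fejér closure (`floor_of_deriv_of_leak`) and the summit matrix (`hasDWavePairFieldLROAt_of_floor`). This is the closing term for a route
restated over {a GRC-type construction target, stmt-1089} with the every-ground-state transfer `SsbToEvenTorusLro` and the Koma–Tasaki
order parameter both DROPPED from the deciding theorem. [folklore] -/
theorem hubbardSuperconductivity_of_gcRepelledChordPoint_of_windowInfraredBound
    (hpt : ∃ U : ℝ, 0 < U ∧ ∃ δ ∈ Set.Ioo (0:ℝ) (1 / 2), ∃ μ : ℝ,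
      Filter.Tendsto (fun L : ℕ => ((hubbardTorusWith 2 (L + 1) 1 U μ).groundStateFunctional totalNumber).re / ((L + 1 : ℕ) : ℝ) ^ 2) Filter.atTop (nhds (1 - δ)) ∧
      (∃ a : ℝ, 0 < a ∧ ∀ R : ℕ, 0 < R → ∃ κ : ℝ, 0 < κ ∧ ∀ᶠ k : ℕ in Filter.atTop, κ * a * ((2 * k + 1 + 1 : ℕ) : ℝ) ^ 2 ≤ (hubbardTorusWith 2 (2 * k + 1 + 1) 1 U μ + (κ : ℂ) • (((((R : ℝ) ^ 4)⁻¹ : ℝ) : ℂ) • ∑ a : Literature.Probability.LatticeModels.TorusSite 2 (2 * k + 1 + 1), (∑ u : Fin 2 → Fin R, localPair dWaveFormFactor (2 * k + 1 + 1) (a + fun i => ((u i : ℕ) : ZMod (2 * k + 1 + 1))))ᴴ * (∑ u : Fin 2 → Fin R, localPair dWaveFormFactor (2 * k + 1 + 1) (a + fun i => ((u i : ℕ) : ZMod (2 * k + 1 + 1)))))).groundEnergy - (hubbardTorusWith 2 (2 * k + 1 + 1) 1 U μ).groundEnergy))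
    (hW : WindowInfraredBound) : _root_.HubbardSuperconductivity := by
  obtain ⟨U, hU, δ, hδ, μ, hdm, hG⟩ := hpt
  have hδ' : δ ∈ Set.Ioo (0:ℝ) 1 := ⟨hδ.1, by linarith [hδ.2]⟩
  have hM : HasDWavePairFieldLROAt U δ :=
    hasDWavePairFieldLROAt_of_floor
      (floor_of_deriv_of_leak (facePurity_of_gcRepelledChordAt hδ' hdm hG) (leak_of_windowInfraredBound hW hU hδ))
  unfold HubbardSuperconductivity Literature.Hubbard.DWaveSuperconductivityHubbard
  exact ⟨U, hU, δ, hδ, hM⟩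

/-- **Box form** (the route's certified box `U ∈ [2,3]`, `δ ∈ [1/5, 7/20]`, i.e. the shape of `FixedPointDWaveOrder` with its conjunct
`HasDWaveOrder U μ` REPLACED by the GRC floor at `(U, μ)`): such a point plus item stmt-1089 gives the summit. [folklore] -/
theorem hubbardSuperconductivity_of_boxPointWithGcRepelledChord_of_windowInfraredBound
    (hpt : ∃ U ∈ Set.Icc (2:ℝ) 3, ∃ δ ∈ Set.Icc (1/5:ℝ) (7/20), ∃ μ : ℝ,
      Filter.Tendsto (fun L : ℕ => ((hubbardTorusWith 2 (L + 1) 1 U μ).groundStateFunctional totalNumber).re / ((L + 1 : ℕ) : ℝ) ^ 2) Filter.atTop (nhds (1 - δ)) ∧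
      (∃ a : ℝ, 0 < a ∧ ∀ R : ℕ, 0 < R → ∃ κ : ℝ, 0 < κ ∧ ∀ᶠ k : ℕ in Filter.atTop, κ * a * ((2 * k + 1 + 1 : ℕ) : ℝ) ^ 2 ≤ (hubbardTorusWith 2 (2 * k + 1 + 1) 1 U μ + (κ : ℂ) • (((((R : ℝ) ^ 4)⁻¹ : ℝ) : ℂ) • ∑ a : Literature.Probability.LatticeModels.TorusSite 2 (2 * k + 1 + 1), (∑ u : Fin 2 → Fin R, localPair dWaveFormFactor (2 * k + 1 + 1) (a + fun i => ((u i : ℕ) : ZMod (2 * k + 1 + 1))))ᴴ * (∑ u : Fin 2 → Fin R, localPair dWaveFormFactor (2 * k + 1 + 1) (a + fun i => ((u i : ℕ) : ZMod (2 * k + 1 + 1)))))).groundEnergy - (hubbardTorusWith 2 (2 * k + 1 + 1) 1 U μ).groundEnergy))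
    (hW : WindowInfraredBound) : _root_.HubbardSuperconductivity := by
  obtain ⟨U, hU, δ, hδ, μ, hdm, hG⟩ := hpt
  exact hubbardSuperconductivity_of_gcRepelledChordPoint_of_windowInfraredBound
    ⟨U, by linarith [hU.1], δ, ⟨by linarith [hδ.1], by linarith [hδ.2]⟩, μ, hdm, hG⟩ hW

end Summit.HubbardSuperconductivity.HubbardSuperconductivity.Theorems

end
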